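import Summits.HodgeConjecture.HodgeConjecture.Theorems.Ring2WeilCoverageCMFieldRationalClassesFibres
import Summits.HodgeConjecture.HodgeConjecture.Theorems.Ring2WeilCoverageCMFieldRationalPrimeRule
import HarnessLib

/-!
# Ring 2 — Weil-family coverage, CM-field rows: RATIONAL classes are constant on the fibres of `Spec 𝓞_F → Spec ℤ`,
  instances II: the five quartic CM subfields of `ℚ(ζ₄₀)` outside the census (`ℚ(i,√10)`, `ℚ(√-5,√2)`, `ℚ(√-2,√5)`, `ℚ(√-2,√-5)`, `ℚ(√-(5+√5))`) (WEIL-FAMILY-COVERAGE «## b03», cell (xxi′)(a), part 35)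

research route conditional on HC_CM; not a corollary; Q11.4-sentence-2 already refuted in dim ≥ 3.

For each quartic CM field `E` below, over its Deligne carrier `R = S² + pS + q` (`F = ℚ[S]/(R)`, `E = F(√θ)`; explicit `hR` in
every signature) [cite: Deligne1982HodgeCycles, §4 p. 30, (1), Cor. 4.2], part 33's table theorems are instantiated:
* `KEY_inl_mem_badPlaces_ratCast_iff` — **for every `c ∈ ℚ^×` and every odd prime `ℓ` (`ℓ ∤ b₀`, resp. `ℓ ∤ q`), `T(c)`
  contains BOTH places of `F` over `ℓ` or NONE** (biquadratic `E = F(√b₀)`: `θ = c₁²·b₀` written out and checked by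
  `linear_combination`; cyclic `E`: `q = s₀²` with `s₀ ∈ ℤ[θ]` written out);
* `KEY_badPlaces_ratCast_ne_pair` — **row form: `T(c) ≠ {v, w}` whenever `v ≠ v'` lie over such an `ℓ` and `w ≠ v'`**: a
  `|T| = 2` row of the table `W_{2k}.E.T` through ONE place of a split prime has no rational member — the «–» entries of
  §b03.5 / §b03.29 (2), for every rational number and every such row at once;
* where `F` has an odd ramified prime `ℓ₀ ∤ b₀`: `KEY_inl_notMem_badPlaces_ratCast_of_mem_…` — **the place over `ℓ₀` lies
  in NO `T(c)`** (`π = 2θ + p`, `π² = disc R = ℓ₀·w`, `(ℓ₀, w) = 1`, `e = 2`), with its row form `T(c) ≠ {v, w}` for all `w`.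
* §95 `ℚ(i,√10)` (`R = S² + 22S + 81`; `b₀ = -1`; ramified prime(s) 5).
* §96 `ℚ(√-5,√2)` (`R = S² + 30S + 25`; `b₀ = -5`).
* §97 `ℚ(√-2,√5)` (`R = S² + 6S + 4`; `b₀ = -2`; ramified prime(s) 5).
* §98 `ℚ(√-2,√-5)` (`R = S² + 14S + 9`; `b₀ = -2`; ramified prime(s) 5).
* §99 `ℚ(√-(5+√5))` (`R = S² + 10S + 20`; cyclic, `q = 20`).

No new definition, no named fact, no sorry; nothing about the Hodge conjecture is asserted.
-/

noncomputable section

set_option linter.dupNamespace false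

open Polynomial NumberField IsDedekindDomain

namespace Summit.HodgeConjecture.HodgeConjecture.Ring2.WeilCoverageCM

open Literature.AlgebraicGeometry.Deligne1982
open Literature.AlgebraicGeometry.HodgeTheory (splitDiscriminantClassCM)
open Literature.NumberTheory.QuadraticForms

variable {R : Polynomial ℤ} [Fact (Irreducible (cmPolyQ R))] [Fact (Irreducible (realPolyQ R))]

/-! ### §95 `E = ℚ(i,√10)` (`R = S² + 22S + 81`, `F = ℚ(√10)`, `E = F(√-1)`) -/
section IsqrtNeg1Sqrt10

omit [Fact (Irreducible (cmPolyQ R))] in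
/-- `ℚ(i,√10)` (`R = S² + 22S + 81`): **`θ = c₁²·(-1)`** with `c₁ = -9/2 + (-1/2)·θ` — `E = F(√-1)`, `F = ℚ(√10)`.
[cite: Deligne1982HodgeCycles, §4 p. 30] -/
theorem sqrtNeg1Sqrt10_root_eq_sq_mul_neg_one (hR : R = X ^ 2 + C 22 * X + C 81) :
    AdjoinRoot.root (realPolyQ R) = ((-9/2 : realField R) + (-1/2 : realField R) * AdjoinRoot.root (realPolyQ R)) ^ 2
      * (((-(1 : ℕ) : ℤ) : 𝓞 (realField R)) : realField R) := by
  have hrel := root_rel_quadratic hR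
  push_cast at hrel
  rw [show (((-(1 : ℕ) : ℤ) : 𝓞 (realField R)) : realField R) = ((-(1 : ℕ) : ℤ) : realField R) from
    map_intCast (algebraMap (𝓞 (realField R)) (realField R)) _]
  push_cast
  linear_combination (1/4 : realField R) * hrel

/-- **`ℚ(i,√10)`: for EVERY `c ∈ ℚ^×` and every odd prime `ℓ`, `T(c)` contains BOTH places of `F = ℚ(√10)` over `ℓ`
or NONE** — the rational classes of the table `W_{2k}.E.T` are constant on the fibres of `Spec 𝓞_F → Spec ℤ`.
[cite: Deligne1982HodgeCycles, §4 (1)] [cite: Omeara1963, §63B Cor. 63:11a and Example 63:12] -/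
theorem sqrtNeg1Sqrt10_inl_mem_badPlaces_ratCast_iff (hR : R = X ^ 2 + C 22 * X + C 81) {ℓ : ℕ} (hℓ : ℓ.Prime)
    (hℓ2 : ℓ ≠ 2) (v v' : HeightOneSpectrum (𝓞 (realField R)))
    (hv : (ℓ : 𝓞 (realField R)) ∈ v.asIdeal) (hv' : (ℓ : 𝓞 (realField R)) ∈ v'.asIdeal) {c : ℚ} (hc : c ≠ 0) :
    Sum.inl v ∈ badPlaces (c : realField R) (AdjoinRoot.root (realPolyQ R)) ↔
      Sum.inl v' ∈ badPlaces (c : realField R) (AdjoinRoot.root (realPolyQ R)) :=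
  inl_mem_badPlaces_ratCast_iff_of_intCast_radicand hR (sqrtNeg1Sqrt10_root_eq_sq_mul_neg_one hR) hℓ hℓ2
    (not_natCast_dvd_neg_natCast hℓ (Or.inl rfl) hℓ.one_lt.ne') v v' hv hv' hc

/-- **`ℚ(i,√10)`, row form: a `|T| = 2` row `{v, w}` with `v ≠ v'` the two places over an odd prime `ℓ` and
`w ≠ v'` has NO RATIONAL MEMBER**: `T(c) ≠ {v, w}` for every `c ∈ ℚ^×` (the «least rational n: –» rows, for every `n`).
[cite: Deligne1982HodgeCycles, §4 (1) and Cor. 4.2] -/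
theorem sqrtNeg1Sqrt10_badPlaces_ratCast_ne_pair (hR : R = X ^ 2 + C 22 * X + C 81) {ℓ : ℕ} (hℓ : ℓ.Prime)
    (hℓ2 : ℓ ≠ 2) (v v' w : HeightOneSpectrum (𝓞 (realField R)))
    (hv : (ℓ : 𝓞 (realField R)) ∈ v.asIdeal) (hv' : (ℓ : 𝓞 (realField R)) ∈ v'.asIdeal) (hne : v ≠ v') (hw : w ≠ v')
    {c : ℚ} (hc : c ≠ 0) :
    badPlaces (c : realField R) (AdjoinRoot.root (realPolyQ R)) ≠ {Sum.inl v, Sum.inl w} :=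
  badPlaces_ratCast_ne_pair_of_intCast_radicand hR (sqrtNeg1Sqrt10_root_eq_sq_mul_neg_one hR) hℓ hℓ2
    (not_natCast_dvd_neg_natCast hℓ (Or.inl rfl) hℓ.one_lt.ne') v v' w hv hv' hne hw hc

/-- **`ℚ(i,√10)`: the place of `F = ℚ(√10)` over the RAMIFIED prime `5` (inert in `E`) lies in NO `T(c)`, `c ∈ ℚ^×`**
(`π = 2θ + 22`, `π² = 160 = 5·32`, `(13)·5 + (-2)·32 = 1`: `(5, π)² = (5)`, `e = 2`, `ord_v c` even).
[cite: Omeara1963, §63B Cor. 63:11a and Example 63:12] [cite: Deligne1982HodgeCycles, §4 (1)] -/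
theorem sqrtNeg1Sqrt10_inl_notMem_badPlaces_ratCast_of_mem_five (hR : R = X ^ 2 + C 22 * X + C 81)
    (v : HeightOneSpectrum (𝓞 (realField R))) (hv : (5 : 𝓞 (realField R)) ∈ v.asIdeal) {c : ℚ} (hc : c ≠ 0) :
    Sum.inl v ∉ badPlaces (c : realField R) (AdjoinRoot.root (realPolyQ R)) := by
  obtain ⟨hRm, -⟩ := monic_and_natDegree_of_quadratic R hR
  obtain ⟨θₒ, hθ⟩ := exists_ringOfIntegers_coe_eq_root hRm
  have hrel := ringOfIntegers_root_rel_quadratic hR hθ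
  push_cast at hrel
  have hπ : (2 * θₒ + 22) ^ 2 = ((5 : ℕ) : 𝓞 (realField R)) * 32 := by
    push_cast
    linear_combination (4 : 𝓞 (realField R)) * hrel
  have hv' : ((5 : ℕ) : 𝓞 (realField R)) ∈ v.asIdeal := by exact_mod_cast hv
  have hb : (((-(1 : ℕ) : ℤ)) : 𝓞 (realField R)) ∉ v.asIdeal :=
    (intCast_mem_iff_natCast_dvd Nat.prime_five v hv' _).not.2
      (not_natCast_dvd_neg_natCast Nat.prime_five (Or.inl rfl) (by norm_num))
  exact inl_notMem_badPlaces_ratCast_of_sq_eq_mul hR (sqrtNeg1Sqrt10_root_eq_sq_mul_neg_one hR) Nat.prime_five (by norm_num) hπ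
    (a := 13) (b := -2) (by push_cast; ring) v hv' hb hc

/-- **`ℚ(i,√10)`, row form at the ramified prime `5`**: `T(c) ≠ {v, w}` for the place `v ∋ 5`, every place `w` and
every `c ∈ ℚ^×`. [cite: Deligne1982HodgeCycles, §4 (1) and Cor. 4.2] -/
theorem sqrtNeg1Sqrt10_badPlaces_ratCast_ne_pair_of_mem_five (hR : R = X ^ 2 + C 22 * X + C 81)
    (v w : HeightOneSpectrum (𝓞 (realField R))) (hv : (5 : 𝓞 (realField R)) ∈ v.asIdeal) {c : ℚ} (hc : c ≠ 0) :
    badPlaces (c : realField R) (AdjoinRoot.root (realPolyQ R)) ≠ {Sum.inl v, Sum.inl w} := by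
  intro h
  have h1 : Sum.inl v ∈ badPlaces (c : realField R) (AdjoinRoot.root (realPolyQ R)) := by
    rw [h]; exact Set.mem_insert _ _
  exact sqrtNeg1Sqrt10_inl_notMem_badPlaces_ratCast_of_mem_five hR v hv hc h1

end IsqrtNeg1Sqrt10

/-! ### §96 `E = ℚ(√-5,√2)` (`R = S² + 30S + 25`, `F = ℚ(√2)`, `E = F(√-5)`) -/
section IsqrtNeg5Sqrt2

omit [Fact (Irreducible (cmPolyQ R))] in
/-- `ℚ(√-5,√2)` (`R = S² + 30S + 25`): **`θ = c₁²·(-5)`** with `c₁ = -1/2 + (-1/10)·θ` — `E = F(√-5)`, `F = ℚ(√2)`.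
[cite: Deligne1982HodgeCycles, §4 p. 30] -/
theorem sqrtNeg5Sqrt2_root_eq_sq_mul_neg_five (hR : R = X ^ 2 + C 30 * X + C 25) :
    AdjoinRoot.root (realPolyQ R) = ((-1/2 : realField R) + (-1/10 : realField R) * AdjoinRoot.root (realPolyQ R)) ^ 2
      * (((-(5 : ℕ) : ℤ) : 𝓞 (realField R)) : realField R) := by
  have hrel := root_rel_quadratic hR
  push_cast at hrel
  rw [show (((-(5 : ℕ) : ℤ) : 𝓞 (realField R)) : realField R) = ((-(5 : ℕ) : ℤ) : realField R) from
    map_intCast (algebraMap (𝓞 (realField R)) (realField R)) _]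
  push_cast
  linear_combination (1/20 : realField R) * hrel

/-- **`ℚ(√-5,√2)`: for EVERY `c ∈ ℚ^×` and every odd prime `ℓ`, `ℓ ≠ 5`, `T(c)` contains BOTH places of `F = ℚ(√2)` over `ℓ`
or NONE** — the rational classes of the table `W_{2k}.E.T` are constant on the fibres of `Spec 𝓞_F → Spec ℤ`.
[cite: Deligne1982HodgeCycles, §4 (1)] [cite: Omeara1963, §63B Cor. 63:11a and Example 63:12] -/
theorem sqrtNeg5Sqrt2_inl_mem_badPlaces_ratCast_iff (hR : R = X ^ 2 + C 30 * X + C 25) {ℓ : ℕ} (hℓ : ℓ.Prime)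
    (hℓ2 : ℓ ≠ 2) (hℓ5 : ℓ ≠ 5) (v v' : HeightOneSpectrum (𝓞 (realField R)))
    (hv : (ℓ : 𝓞 (realField R)) ∈ v.asIdeal) (hv' : (ℓ : 𝓞 (realField R)) ∈ v'.asIdeal) {c : ℚ} (hc : c ≠ 0) :
    Sum.inl v ∈ badPlaces (c : realField R) (AdjoinRoot.root (realPolyQ R)) ↔
      Sum.inl v' ∈ badPlaces (c : realField R) (AdjoinRoot.root (realPolyQ R)) :=
  inl_mem_badPlaces_ratCast_iff_of_intCast_radicand hR (sqrtNeg5Sqrt2_root_eq_sq_mul_neg_five hR) hℓ hℓ2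
    (not_natCast_dvd_neg_natCast hℓ (Or.inr Nat.prime_five) hℓ5) v v' hv hv' hc

/-- **`ℚ(√-5,√2)`, row form: a `|T| = 2` row `{v, w}` with `v ≠ v'` the two places over an odd prime `ℓ`, `ℓ ≠ 5` and
`w ≠ v'` has NO RATIONAL MEMBER**: `T(c) ≠ {v, w}` for every `c ∈ ℚ^×` (the «least rational n: –» rows, for every `n`).
[cite: Deligne1982HodgeCycles, §4 (1) and Cor. 4.2] -/
theorem sqrtNeg5Sqrt2_badPlaces_ratCast_ne_pair (hR : R = X ^ 2 + C 30 * X + C 25) {ℓ : ℕ} (hℓ : ℓ.Prime)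
    (hℓ2 : ℓ ≠ 2) (hℓ5 : ℓ ≠ 5) (v v' w : HeightOneSpectrum (𝓞 (realField R)))
    (hv : (ℓ : 𝓞 (realField R)) ∈ v.asIdeal) (hv' : (ℓ : 𝓞 (realField R)) ∈ v'.asIdeal) (hne : v ≠ v') (hw : w ≠ v')
    {c : ℚ} (hc : c ≠ 0) :
    badPlaces (c : realField R) (AdjoinRoot.root (realPolyQ R)) ≠ {Sum.inl v, Sum.inl w} :=
  badPlaces_ratCast_ne_pair_of_intCast_radicand hR (sqrtNeg5Sqrt2_root_eq_sq_mul_neg_five hR) hℓ hℓ2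
    (not_natCast_dvd_neg_natCast hℓ (Or.inr Nat.prime_five) hℓ5) v v' w hv hv' hne hw hc

end IsqrtNeg5Sqrt2

/-! ### §97 `E = ℚ(√-2,√5)` (`R = S² + 6S + 4`, `F = ℚ(√5)`, `E = F(√-2)`) -/
section IsqrtNeg2Sqrt5

omit [Fact (Irreducible (cmPolyQ R))] in
/-- `ℚ(√-2,√5)` (`R = S² + 6S + 4`): **`θ = c₁²·(-2)`** with `c₁ = 1 + (1/2)·θ` — `E = F(√-2)`, `F = ℚ(√5)`.
[cite: Deligne1982HodgeCycles, §4 p. 30] -/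
theorem sqrtNeg2Sqrt5_root_eq_sq_mul_neg_two (hR : R = X ^ 2 + C 6 * X + C 4) :
    AdjoinRoot.root (realPolyQ R) = ((1 : realField R) + (1/2 : realField R) * AdjoinRoot.root (realPolyQ R)) ^ 2
      * (((-(2 : ℕ) : ℤ) : 𝓞 (realField R)) : realField R) := by
  have hrel := root_rel_quadratic hR
  push_cast at hrel
  rw [show (((-(2 : ℕ) : ℤ) : 𝓞 (realField R)) : realField R) = ((-(2 : ℕ) : ℤ) : realField R) from
    map_intCast (algebraMap (𝓞 (realField R)) (realField R)) _]
  push_cast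
  linear_combination (1/2 : realField R) * hrel

/-- **`ℚ(√-2,√5)`: for EVERY `c ∈ ℚ^×` and every odd prime `ℓ`, `T(c)` contains BOTH places of `F = ℚ(√5)` over `ℓ`
or NONE** — the rational classes of the table `W_{2k}.E.T` are constant on the fibres of `Spec 𝓞_F → Spec ℤ`.
[cite: Deligne1982HodgeCycles, §4 (1)] [cite: Omeara1963, §63B Cor. 63:11a and Example 63:12] -/
theorem sqrtNeg2Sqrt5_inl_mem_badPlaces_ratCast_iff (hR : R = X ^ 2 + C 6 * X + C 4) {ℓ : ℕ} (hℓ : ℓ.Prime)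
    (hℓ2 : ℓ ≠ 2) (v v' : HeightOneSpectrum (𝓞 (realField R)))
    (hv : (ℓ : 𝓞 (realField R)) ∈ v.asIdeal) (hv' : (ℓ : 𝓞 (realField R)) ∈ v'.asIdeal) {c : ℚ} (hc : c ≠ 0) :
    Sum.inl v ∈ badPlaces (c : realField R) (AdjoinRoot.root (realPolyQ R)) ↔
      Sum.inl v' ∈ badPlaces (c : realField R) (AdjoinRoot.root (realPolyQ R)) :=
  inl_mem_badPlaces_ratCast_iff_of_intCast_radicand hR (sqrtNeg2Sqrt5_root_eq_sq_mul_neg_two hR) hℓ hℓ2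
    (not_natCast_dvd_neg_natCast hℓ (Or.inr Nat.prime_two) hℓ2) v v' hv hv' hc

/-- **`ℚ(√-2,√5)`, row form: a `|T| = 2` row `{v, w}` with `v ≠ v'` the two places over an odd prime `ℓ` and
`w ≠ v'` has NO RATIONAL MEMBER**: `T(c) ≠ {v, w}` for every `c ∈ ℚ^×` (the «least rational n: –» rows, for every `n`).
[cite: Deligne1982HodgeCycles, §4 (1) and Cor. 4.2] -/
theorem sqrtNeg2Sqrt5_badPlaces_ratCast_ne_pair (hR : R = X ^ 2 + C 6 * X + C 4) {ℓ : ℕ} (hℓ : ℓ.Prime)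
    (hℓ2 : ℓ ≠ 2) (v v' w : HeightOneSpectrum (𝓞 (realField R)))
    (hv : (ℓ : 𝓞 (realField R)) ∈ v.asIdeal) (hv' : (ℓ : 𝓞 (realField R)) ∈ v'.asIdeal) (hne : v ≠ v') (hw : w ≠ v')
    {c : ℚ} (hc : c ≠ 0) :
    badPlaces (c : realField R) (AdjoinRoot.root (realPolyQ R)) ≠ {Sum.inl v, Sum.inl w} :=
  badPlaces_ratCast_ne_pair_of_intCast_radicand hR (sqrtNeg2Sqrt5_root_eq_sq_mul_neg_two hR) hℓ hℓ2
    (not_natCast_dvd_neg_natCast hℓ (Or.inr Nat.prime_two) hℓ2) v v' w hv hv' hne hw hc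

/-- **`ℚ(√-2,√5)`: the place of `F = ℚ(√5)` over the RAMIFIED prime `5` (inert in `E`) lies in NO `T(c)`, `c ∈ ℚ^×`**
(`π = 2θ + 6`, `π² = 20 = 5·4`, `(1)·5 + (-1)·4 = 1`: `(5, π)² = (5)`, `e = 2`, `ord_v c` even).
[cite: Omeara1963, §63B Cor. 63:11a and Example 63:12] [cite: Deligne1982HodgeCycles, §4 (1)] -/
theorem sqrtNeg2Sqrt5_inl_notMem_badPlaces_ratCast_of_mem_five (hR : R = X ^ 2 + C 6 * X + C 4)
    (v : HeightOneSpectrum (𝓞 (realField R))) (hv : (5 : 𝓞 (realField R)) ∈ v.asIdeal) {c : ℚ} (hc : c ≠ 0) :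
    Sum.inl v ∉ badPlaces (c : realField R) (AdjoinRoot.root (realPolyQ R)) := by
  obtain ⟨hRm, -⟩ := monic_and_natDegree_of_quadratic R hR
  obtain ⟨θₒ, hθ⟩ := exists_ringOfIntegers_coe_eq_root hRm
  have hrel := ringOfIntegers_root_rel_quadratic hR hθ
  push_cast at hrel
  have hπ : (2 * θₒ + 6) ^ 2 = ((5 : ℕ) : 𝓞 (realField R)) * 4 := by
    push_cast
    linear_combination (4 : 𝓞 (realField R)) * hrel
  have hv' : ((5 : ℕ) : 𝓞 (realField R)) ∈ v.asIdeal := by exact_mod_cast hv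
  have hb : (((-(2 : ℕ) : ℤ)) : 𝓞 (realField R)) ∉ v.asIdeal :=
    (intCast_mem_iff_natCast_dvd Nat.prime_five v hv' _).not.2
      (not_natCast_dvd_neg_natCast Nat.prime_five (Or.inr Nat.prime_two) (by norm_num))
  exact inl_notMem_badPlaces_ratCast_of_sq_eq_mul hR (sqrtNeg2Sqrt5_root_eq_sq_mul_neg_two hR) Nat.prime_five (by norm_num) hπ
    (a := 1) (b := -1) (by push_cast; ring) v hv' hb hc

/-- **`ℚ(√-2,√5)`, row form at the ramified prime `5`**: `T(c) ≠ {v, w}` for the place `v ∋ 5`, every place `w` and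
every `c ∈ ℚ^×`. [cite: Deligne1982HodgeCycles, §4 (1) and Cor. 4.2] -/
theorem sqrtNeg2Sqrt5_badPlaces_ratCast_ne_pair_of_mem_five (hR : R = X ^ 2 + C 6 * X + C 4)
    (v w : HeightOneSpectrum (𝓞 (realField R))) (hv : (5 : 𝓞 (realField R)) ∈ v.asIdeal) {c : ℚ} (hc : c ≠ 0) :
    badPlaces (c : realField R) (AdjoinRoot.root (realPolyQ R)) ≠ {Sum.inl v, Sum.inl w} := by
  intro h
  have h1 : Sum.inl v ∈ badPlaces (c : realField R) (AdjoinRoot.root (realPolyQ R)) := by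
    rw [h]; exact Set.mem_insert _ _
  exact sqrtNeg2Sqrt5_inl_notMem_badPlaces_ratCast_of_mem_five hR v hv hc h1

end IsqrtNeg2Sqrt5

/-! ### §98 `E = ℚ(√-2,√-5)` (`R = S² + 14S + 9`, `F = ℚ(√10)`, `E = F(√-2)`) -/
section IsqrtNeg2SqrtNeg5

omit [Fact (Irreducible (cmPolyQ R))] in
/-- `ℚ(√-2,√-5)` (`R = S² + 14S + 9`): **`θ = c₁²·(-2)`** with `c₁ = -3/4 + (-1/4)·θ` — `E = F(√-2)`, `F = ℚ(√10)`.
[cite: Deligne1982HodgeCycles, §4 p. 30] -/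
theorem sqrtNeg2SqrtNeg5_root_eq_sq_mul_neg_two (hR : R = X ^ 2 + C 14 * X + C 9) :
    AdjoinRoot.root (realPolyQ R) = ((-3/4 : realField R) + (-1/4 : realField R) * AdjoinRoot.root (realPolyQ R)) ^ 2
      * (((-(2 : ℕ) : ℤ) : 𝓞 (realField R)) : realField R) := by
  have hrel := root_rel_quadratic hR
  push_cast at hrel
  rw [show (((-(2 : ℕ) : ℤ) : 𝓞 (realField R)) : realField R) = ((-(2 : ℕ) : ℤ) : realField R) from
    map_intCast (algebraMap (𝓞 (realField R)) (realField R)) _]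
  push_cast
  linear_combination (1/8 : realField R) * hrel

/-- **`ℚ(√-2,√-5)`: for EVERY `c ∈ ℚ^×` and every odd prime `ℓ`, `T(c)` contains BOTH places of `F = ℚ(√10)` over `ℓ`
or NONE** — the rational classes of the table `W_{2k}.E.T` are constant on the fibres of `Spec 𝓞_F → Spec ℤ`.
[cite: Deligne1982HodgeCycles, §4 (1)] [cite: Omeara1963, §63B Cor. 63:11a and Example 63:12] -/
theorem sqrtNeg2SqrtNeg5_inl_mem_badPlaces_ratCast_iff (hR : R = X ^ 2 + C 14 * X + C 9) {ℓ : ℕ} (hℓ : ℓ.Prime)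
    (hℓ2 : ℓ ≠ 2) (v v' : HeightOneSpectrum (𝓞 (realField R)))
    (hv : (ℓ : 𝓞 (realField R)) ∈ v.asIdeal) (hv' : (ℓ : 𝓞 (realField R)) ∈ v'.asIdeal) {c : ℚ} (hc : c ≠ 0) :
    Sum.inl v ∈ badPlaces (c : realField R) (AdjoinRoot.root (realPolyQ R)) ↔
      Sum.inl v' ∈ badPlaces (c : realField R) (AdjoinRoot.root (realPolyQ R)) :=
  inl_mem_badPlaces_ratCast_iff_of_intCast_radicand hR (sqrtNeg2SqrtNeg5_root_eq_sq_mul_neg_two hR) hℓ hℓ2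
    (not_natCast_dvd_neg_natCast hℓ (Or.inr Nat.prime_two) hℓ2) v v' hv hv' hc

/-- **`ℚ(√-2,√-5)`, row form: a `|T| = 2` row `{v, w}` with `v ≠ v'` the two places over an odd prime `ℓ` and
`w ≠ v'` has NO RATIONAL MEMBER**: `T(c) ≠ {v, w}` for every `c ∈ ℚ^×` (the «least rational n: –» rows, for every `n`).
[cite: Deligne1982HodgeCycles, §4 (1) and Cor. 4.2] -/
theorem sqrtNeg2SqrtNeg5_badPlaces_ratCast_ne_pair (hR : R = X ^ 2 + C 14 * X + C 9) {ℓ : ℕ} (hℓ : ℓ.Prime)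
    (hℓ2 : ℓ ≠ 2) (v v' w : HeightOneSpectrum (𝓞 (realField R)))
    (hv : (ℓ : 𝓞 (realField R)) ∈ v.asIdeal) (hv' : (ℓ : 𝓞 (realField R)) ∈ v'.asIdeal) (hne : v ≠ v') (hw : w ≠ v')
    {c : ℚ} (hc : c ≠ 0) :
    badPlaces (c : realField R) (AdjoinRoot.root (realPolyQ R)) ≠ {Sum.inl v, Sum.inl w} :=
  badPlaces_ratCast_ne_pair_of_intCast_radicand hR (sqrtNeg2SqrtNeg5_root_eq_sq_mul_neg_two hR) hℓ hℓ2
    (not_natCast_dvd_neg_natCast hℓ (Or.inr Nat.prime_two) hℓ2) v v' w hv hv' hne hw hc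

/-- **`ℚ(√-2,√-5)`: the place of `F = ℚ(√10)` over the RAMIFIED prime `5` (inert in `E`) lies in NO `T(c)`, `c ∈ ℚ^×`**
(`π = 2θ + 14`, `π² = 160 = 5·32`, `(13)·5 + (-2)·32 = 1`: `(5, π)² = (5)`, `e = 2`, `ord_v c` even).
[cite: Omeara1963, §63B Cor. 63:11a and Example 63:12] [cite: Deligne1982HodgeCycles, §4 (1)] -/
theorem sqrtNeg2SqrtNeg5_inl_notMem_badPlaces_ratCast_of_mem_five (hR : R = X ^ 2 + C 14 * X + C 9)
    (v : HeightOneSpectrum (𝓞 (realField R))) (hv : (5 : 𝓞 (realField R)) ∈ v.asIdeal) {c : ℚ} (hc : c ≠ 0) :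
    Sum.inl v ∉ badPlaces (c : realField R) (AdjoinRoot.root (realPolyQ R)) := by
  obtain ⟨hRm, -⟩ := monic_and_natDegree_of_quadratic R hR
  obtain ⟨θₒ, hθ⟩ := exists_ringOfIntegers_coe_eq_root hRm
  have hrel := ringOfIntegers_root_rel_quadratic hR hθ
  push_cast at hrel
  have hπ : (2 * θₒ + 14) ^ 2 = ((5 : ℕ) : 𝓞 (realField R)) * 32 := by
    push_cast
    linear_combination (4 : 𝓞 (realField R)) * hrel
  have hv' : ((5 : ℕ) : 𝓞 (realField R)) ∈ v.asIdeal := by exact_mod_cast hv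
  have hb : (((-(2 : ℕ) : ℤ)) : 𝓞 (realField R)) ∉ v.asIdeal :=
    (intCast_mem_iff_natCast_dvd Nat.prime_five v hv' _).not.2
      (not_natCast_dvd_neg_natCast Nat.prime_five (Or.inr Nat.prime_two) (by norm_num))
  exact inl_notMem_badPlaces_ratCast_of_sq_eq_mul hR (sqrtNeg2SqrtNeg5_root_eq_sq_mul_neg_two hR) Nat.prime_five (by norm_num) hπ
    (a := 13) (b := -2) (by push_cast; ring) v hv' hb hc

/-- **`ℚ(√-2,√-5)`, row form at the ramified prime `5`**: `T(c) ≠ {v, w}` for the place `v ∋ 5`, every place `w` and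
every `c ∈ ℚ^×`. [cite: Deligne1982HodgeCycles, §4 (1) and Cor. 4.2] -/
theorem sqrtNeg2SqrtNeg5_badPlaces_ratCast_ne_pair_of_mem_five (hR : R = X ^ 2 + C 14 * X + C 9)
    (v w : HeightOneSpectrum (𝓞 (realField R))) (hv : (5 : 𝓞 (realField R)) ∈ v.asIdeal) {c : ℚ} (hc : c ≠ 0) :
    badPlaces (c : realField R) (AdjoinRoot.root (realPolyQ R)) ≠ {Sum.inl v, Sum.inl w} := by
  intro h
  have h1 : Sum.inl v ∈ badPlaces (c : realField R) (AdjoinRoot.root (realPolyQ R)) := by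
    rw [h]; exact Set.mem_insert _ _
  exact sqrtNeg2SqrtNeg5_inl_notMem_badPlaces_ratCast_of_mem_five hR v hv hc h1

end IsqrtNeg2SqrtNeg5

/-! ### §99 `E = ℚ(√-(5+√5))` (`R = S² + 10S + 20`, `F = ℚ(√5)`, `E/ℚ` cyclic: `q = 20 = s₀²`, `s₀ = 10 + 2θ`) -/
section IsqrtNegFivePlusSqrtFive

/-- **`ℚ(√-(5+√5))` (cyclic): for EVERY `c ∈ ℚ^×` and every odd prime `ℓ`, `ℓ ≠ 5`, `T(c)` contains BOTH places of
`F = ℚ(√5)` over `ℓ` or NONE** (`q = 20 = (10 + 2θ)²` in `ℤ[θ]`: the residues of `θ` at the two places over a split `ℓ` are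
the two roots of `R̄`, of square product). [cite: Deligne1982HodgeCycles, §4 (1)] [cite: Omeara1963, §63B Cor. 63:11a] -/
theorem sqrtNegFivePlusSqrtFive_inl_mem_badPlaces_ratCast_iff (hR : R = X ^ 2 + C 10 * X + C 20) {ℓ : ℕ} (hℓ : ℓ.Prime)
    (hℓ2 : ℓ ≠ 2) (hℓ5 : ℓ ≠ 5) (v v' : HeightOneSpectrum (𝓞 (realField R)))
    (hv : (ℓ : 𝓞 (realField R)) ∈ v.asIdeal) (hv' : (ℓ : 𝓞 (realField R)) ∈ v'.asIdeal) {c : ℚ} (hc : c ≠ 0) :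
    Sum.inl v ∈ badPlaces (c : realField R) (AdjoinRoot.root (realPolyQ R)) ↔
      Sum.inl v' ∈ badPlaces (c : realField R) (AdjoinRoot.root (realPolyQ R)) := by
  obtain ⟨hRm, -⟩ := monic_and_natDegree_of_quadratic R hR
  obtain ⟨θₒ, hθ⟩ := exists_ringOfIntegers_coe_eq_root hRm
  have hrel := ringOfIntegers_root_rel_quadratic hR hθ
  push_cast at hrel
  have hs : ((10 : 𝓞 (realField R)) + 2 * θₒ) ^ 2 = ((20 : ℤ) : 𝓞 (realField R)) := by
    push_cast
    linear_combination (4 : 𝓞 (realField R)) * hrel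
  have hℓq : ¬ (ℓ : ℤ) ∣ 20 := fun h ↦ by
    have h' : ℓ ∣ 2 ^ 2 * 3 ^ 0 * 5 ^ 1 := by norm_num; exact_mod_cast h
    rcases eq_of_prime_dvd_two_pow_mul hℓ h' with rfl | rfl | rfl <;> omega
  exact inl_mem_badPlaces_ratCast_iff_of_sq_eq hR hθ hs hℓ hℓ2 hℓq v v' hv hv' hc

/-- **`ℚ(√-(5+√5))`, row form: a `|T| = 2` row `{v, w}` with `v ≠ v'` the two places over an odd prime `ℓ`, `ℓ ≠ 5`
and `w ≠ v'` has NO RATIONAL MEMBER**: `T(c) ≠ {v, w}` for every `c ∈ ℚ^×`.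
[cite: Deligne1982HodgeCycles, §4 (1) and Cor. 4.2] -/
theorem sqrtNegFivePlusSqrtFive_badPlaces_ratCast_ne_pair (hR : R = X ^ 2 + C 10 * X + C 20) {ℓ : ℕ} (hℓ : ℓ.Prime)
    (hℓ2 : ℓ ≠ 2) (hℓ5 : ℓ ≠ 5) (v v' w : HeightOneSpectrum (𝓞 (realField R)))
    (hv : (ℓ : 𝓞 (realField R)) ∈ v.asIdeal) (hv' : (ℓ : 𝓞 (realField R)) ∈ v'.asIdeal) (hne : v ≠ v') (hw : w ≠ v')
    {c : ℚ} (hc : c ≠ 0) :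
    badPlaces (c : realField R) (AdjoinRoot.root (realPolyQ R)) ≠ {Sum.inl v, Sum.inl w} := by
  intro h
  have h1 : Sum.inl v ∈ badPlaces (c : realField R) (AdjoinRoot.root (realPolyQ R)) := by
    rw [h]; exact Set.mem_insert _ _
  have h2 := (sqrtNegFivePlusSqrtFive_inl_mem_badPlaces_ratCast_iff hR hℓ hℓ2 hℓ5 v v' hv hv' hc).1 h1
  rw [h, Set.mem_insert_iff, Set.mem_singleton_iff] at h2
  rcases h2 with h2 | h2
  · exact hne (Sum.inl_injective h2).symm
  · exact hw (Sum.inl_injective h2).symm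

end IsqrtNegFivePlusSqrtFive

end Summit.HodgeConjecture.HodgeConjecture.Ring2.WeilCoverageCM

end
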